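import Summits.ABC.IUTFork.Cor312TameQuadMoverInstance
import Summits.ABC.IUTFork.Cor312ProvK
import Literature.IUT.LogVolume.Corollary22TwoAdicIntegrality
import HarnessLib

/-!
# [IUTchIII] Cor. 3.12 — the REALISING pilot datum at the boundary of the tame multi-slot window, part 1 (the datum):
# `X72 = (ℚ(√7), j_E = 7⁻⁵, S = {v₇}, l = 5)`

Definition-bearing instance file of the abc-iut cell (block C / W6 cone prover abc-iut-w6-d114, gen 4; row «X72-REALISING»,
the add-on to abc-iut-w5-d180's ℚ(√7) inhabitant `Cor312LicenceShallowMultiSlotF7` (p442550) offered 2026-08-26T11:48:57Z;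
quadratic twin of this seat's `Cor312LicenceShallowConcreteDatum` (p441984)). TAKES NO SIDE on [IUTchIII] Cor. 3.12 or on any
author. The compositions live in the proof-only sequel `Cor312LicenceShallowConcreteDatumQuadLicence`.

abc-iut-w5-d180's p442550 proves the (xi-f) licence over abc-iut-c312-14's `F7 = ℚ(√7)` for every pilot datum with `S ⊆ {v₇}`,
`l⋇ = 2`, and ideles of the SHAPE `‖t_q‖ = ‖ϖ‖`, `‖t_{Θ,i}‖ = ‖ϖ‖^{(i+1)²}` at `v₇`, and exhibits the datum `j_E = 1/√7`
(`ord_{v₇}(q) = 1`), whose shape-ideles are NOT the ideles REALISING its pilot divisors in Dupuy–Hilado's normalisation (3.4)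
(abc-iut-c312-7's `ht`/`htq`, the hypotheses the C-cert certificates carry: `‖t_q‖ = 7^{−P_q/e} = 7^{−1/20}` there). THIS FILE
supplies the datum at which the shape IS the realising form:

* §1 the place `v₇` in the `LogVolume` place-set language: `v₇ ∈ V(F7)₇`, `e = 2` (`ramIdx`, from abc-iut-c312-14's
  `ramificationIdx_v7`), `f = 1`, `ln|κ(v₇)| = ln 7`, `ord_{v₇}(7) = 2` (`Cor22.ord_natCast_eq_ramIdx`), `ord_{v₇}(7⁻⁵) = −10`;
* §2 **`X72 : PilotData F7 := ⟨j_E := 7⁻⁵, S := {v₇}, l := 5⟩`**: `ord_{v₇}(q) = 10 = 2l`, so abc-iut-c312-3's divisibility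
  **`Cor312Prov.TwoMulLDvdOrdq X72`** HOLDS (realising Θ- and q-ideles EXIST) and **`P_q(v₇) = 1`** — i.e. realising ideles have
  `‖t_q‖ = 7^{−1/2} = ‖ϖ‖`, `‖t_{Θ,i}‖ = ‖ϖ‖^{(i+1)²}`; `l⋇ = 2`; `deĝ(P_q) = ln 7`, `deĝ̲(P_q) = |log(q)| = (ln 7)/2`;
* §2 `not_lastSlot_window_X72` — the ONE-FACTOR degree window of abc-iut-w5-d236's `Cor312LicenceShallowRealising` (p439445;
  `(l⋇)²·P_q(v) < e_v + 1`) FAILS at `X72` (`4 < 3` is false): only the multi-slot mechanism reaches this datum (boundary case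
  `m_q = 1 = e·⌈m_Θ/e⌉ − (j+1)(e−1)`, `e = 2`, `j = 2`, `m_Θ = 4`).

READING (neutral; numbers, not adjectives). PilotData level ONLY: whether GENUINE initial Θ-data (K-level provenance,
abc-iut-C-cert-3 v5K) realise such a datum is NOT claimed. [folklore] number theory over abc-iut-c312-14's `Cor312TameQuadInstance`;
[cite: DupuyHilado2025, §2.5.4, §3.3, §3.4]; [cite: Mochizuki2012, IUTchI Ex. 3.2 (iv) p. 71] for `2l ∣ ord_v(q_v)`;
[claim: Mochizuki2012, status: disputed] for every IUT sentence quoted. typed ≠ proved; instantiated ≠ endorsed.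
-/

noncomputable section

namespace Summit.ABC.IUTFork.ConcreteDatumQuad

open NumberField IsDedekindDomain
open Literature.IUT.LogVolume
open Summit.ABC.IUTFork.RamifiedMover
open Summit.ABC.IUTFork.Thm311.Real (logVolume_residueChar_v7)

/-! ## §1. The place `v₇` of `ℚ(√7)` in the place-set language -/

/-- `7` is prime (instance for `placesOver F7 7`). [folklore] -/
instance fact_prime_seven : Fact (Nat.Prime 7) := ⟨by norm_num⟩

/-- `v₇ ∈ V(F7)₇`. [folklore] -/
theorem v7_mem_placesOver : v7 ∈ placesOver ↥F7 7 :=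
  (mem_placesOver_iff_residueChar v7).mpr logVolume_residueChar_v7

/-- `e(v₇ | 7) = 2` in the `ramIdx` language (abc-iut-c312-14's `ramificationIdx_v7`). [folklore] -/
theorem ramIdx_v7 : ramIdx ↥F7 v7 = 2 := by
  rw [ramIdx_eq, ramificationIdx_v7]

/-- `f(v₇ | 7) = 1` in the `resDeg` language (`e f ≤ Σ_{w ∣ 7} e_w f_w = [F7 : ℚ] = 2`).
[cite: NeukirchANT1999, Ch. I §8 Prop. (8.2)] -/
theorem resDeg_v7 : resDeg ↥F7 v7 = 1 := by
  have hsum : ∑ w ∈ placesOver ↥F7 7, localDegree ↥F7 w = 2 := by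
    rw [sum_localDegree, finrank_F7]
  have hle : localDegree ↥F7 v7 ≤ ∑ w ∈ placesOver ↥F7 7, localDegree ↥F7 w :=
    Finset.single_le_sum (fun w _ => Nat.zero_le (localDegree ↥F7 w)) v7_mem_placesOver
  have hf0 : resDeg ↥F7 v7 ≠ 0 := resDeg_ne_zero ↥F7 v7
  rw [hsum] at hle
  unfold localDegree at hle
  rw [ramIdx_v7] at hle
  omega

/-- `ln|κ(v₇)| = ln 7`. [cite: DupuyHilado2025, §2.5.4] -/
theorem logNorm_v7 : logNorm ↥F7 v7 = Real.log 7 := by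
  rw [logNorm_eq, resDeg_v7, logVolume_residueChar_v7]
  push_cast
  ring

/-- `ord_{v₇}(7) = e(v₇ | 7) = 2`. [folklore] -/
theorem ord_seven_v7 : ord ↥F7 v7 (7 : ↥F7) = 2 := by
  have h := Cor22.ord_natCast_eq_ramIdx 7 v7 v7_mem_placesOver
  rw [ramIdx_v7] at h
  exact_mod_cast h

/-- `ord_{v₇}(7⁻⁵) = −10`. [folklore] -/
theorem ord_jE_v7 : ord ↥F7 v7 (((7 : ↥F7)⁻¹) ^ 5) = -10 := by
  rw [ord_pow, ord_inv, ord_seven_v7]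
  norm_num

/-! ## §2. The realising pilot datum `X72` -/

/-- **The concrete pilot datum `X72`**: `F = ℚ(√7)`, `j_E = 7⁻⁵` (`ord_{v₇}(j_E) = −10 < 0`), `S = {v₇}`, `l = 5`.
[cite: DupuyHilado2025, §3.3] -/
def X72 : PilotData ↥F7 where
  jE := ((7 : ↥F7)⁻¹) ^ 5
  S := {v7}
  S_nonempty := ⟨v7, Finset.mem_singleton_self _⟩
  ord_jE_neg v hv := by
    rw [Finset.mem_singleton] at hv
    subst hv
    rw [ord_jE_v7]
    norm_num
  l := 5
  l_prime := by norm_num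
  five_le_l := le_rfl

/-- `X72.S = {v₇}`. [cite: DupuyHilado2025, §3.3] -/
theorem X72_S : X72.S = {v7} := rfl

/-- Every bad place of `X72` is `v₇` (the shape of abc-iut-w5-d180's hypothesis `hS`). [cite: DupuyHilado2025, §3.3] -/
theorem eq_v7_of_mem_X72_S : ∀ v ∈ X72.S, v = v7 := fun v hv => by
  rw [X72_S, Finset.mem_singleton] at hv
  exact hv

/-- `X72.l = 5`. [cite: DupuyHilado2025, §3.3] -/
theorem X72_l : X72.l = 5 := rfl

/-- `l⋇ = 2` for `X72` (the shape of abc-iut-w5-d180's hypothesis `hl`). [cite: DupuyHilado2025, §3.3] -/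
theorem X72_lstar : X72.lstar = 2 := rfl

/-- `ord_v(q_v) = 10` at every bad place of `X72`. [cite: DupuyHilado2025, §3.2–3.3] -/
theorem X72_ordq {v : HeightOneSpectrum (𝓞 ↥F7)} (hv : v ∈ X72.S) : X72.ordq v = 10 := by
  have hv7 := eq_v7_of_mem_X72_S v hv
  subst hv7
  unfold PilotData.ordq
  rw [show X72.jE = ((7 : ↥F7)⁻¹) ^ 5 from rfl, ord_jE_v7]
  norm_num

/-- **`2l ∣ ord_v(q_v)` on `S`** (`10 ∣ 10`): abc-iut-c312-3's divisibility HOLDS at `X72`, so realising Θ- and q-ideles exist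
there (`Cor312Prov.exists_realising_{q,theta}Ideles_of_twoMulLDvdOrdq`). [cite: Mochizuki2012, IUTchI Ex. 3.2 (iv) p. 71] -/
theorem twoMulLDvdOrdq_X72 : Cor312Prov.TwoMulLDvdOrdq X72 := by
  intro w hw
  rw [X72_ordq hw, X72_l]
  norm_num

/-- **`P_q(v) = 1`** at every bad place of `X72` (`= ord_v(q_v)/(2l) = 10/10`): realising q-ideles have `‖t_q‖ = 7^{−1/2} = ‖ϖ‖`.
[cite: DupuyHilado2025, §3.3] -/
theorem X72_qPilot {v : HeightOneSpectrum (𝓞 ↥F7)} (hv : v ∈ X72.S) : X72.qPilot v = 1 := by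
  rw [X72.qPilot_apply_of_mem hv, X72_ordq hv, X72_l]
  norm_num

/-- Every bad place of `X72` is tame (`p = 7 > 2`, `e = 2 ≤ 5`). [folklore] -/
theorem htame_X72 :
    ∀ v ∈ X72.S, 2 < Literature.IUT.LogVolume.residueChar ↥F7 v ∧
      ramIdx ↥F7 v ≤ Literature.IUT.LogVolume.residueChar ↥F7 v - 2 := by
  intro v hv
  have hv7 := eq_v7_of_mem_X72_S v hv
  subst hv7
  rw [logVolume_residueChar_v7, ramIdx_v7]
  norm_num

/-- **The one-factor degree window of abc-iut-w5-d236's `Cor312LicenceShallowRealising` FAILS at `X72`**: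
`(l⋇)²·P_q(v₇) = 4 < e + 1 = 3` is false — the realising quadratic datum is NOT covered by the last-slot theorem p439445.
[cite: DupuyHilado2025, §3.3–3.4] -/
theorem not_lastSlot_window_X72 :
    ¬ ∀ v ∈ X72.S, 1 ≤ X72.qPilot v ∧ ((X72.lstar : ℕ) : ℝ) ^ 2 * X72.qPilot v < (ramIdx ↥F7 v : ℝ) + 1 := by
  intro h
  have hv : v7 ∈ X72.S := by rw [X72_S]; exact Finset.mem_singleton_self _
  have h2 := (h v7 hv).2
  rw [X72_qPilot hv, X72_lstar, ramIdx_v7] at h2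
  norm_num at h2

/-- **`deĝ(P_q) = ln 7`** for `X72` (`P_q = 1·[v₇]`, `ln|κ(v₇)| = ln 7`). [cite: DupuyHilado2025, §2.5.4, §3.3] -/
theorem deg_qPilot_X72 : FinDivisor.deg ↥F7 X72.qPilot = Real.log 7 := by
  rw [PilotData.qPilot, FinDivisor.deg_sum_of]
  have h : ∀ v ∈ X72.S, (X72.ordq v : ℝ) / (2 * X72.l) * logNorm ↥F7 v = Real.log 7 := by
    intro v hv
    have hv7 := eq_v7_of_mem_X72_S v hv
    rw [X72_ordq hv, X72_l, hv7, logNorm_v7]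
    norm_num
  rw [Finset.sum_congr rfl h, Finset.sum_const, X72_S, Finset.card_singleton]
  simp

/-- **`deĝ̲(P_q) = |log(q)| = (ln 7)/2`** for `X72` (`[F7 : ℚ] = 2`). [cite: DupuyHilado2025, §2.5.4, §3.3] -/
theorem ndeg_qPilot_X72 : FinDivisor.ndeg ↥F7 X72.qPilot = Real.log 7 / 2 := by
  rw [FinDivisor.ndeg_apply, deg_qPilot_X72, finrank_F7]
  norm_num

end Summit.ABC.IUTFork.ConcreteDatumQuad

end
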